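import Mathlib.NumberTheory.Padics.Complex
import Mathlib.NumberTheory.Padics.PadicIntegers
import Mathlib.RingTheory.AdicCompletion.Basic
import Mathlib.RingTheory.LocalRing.ResidueField.Basic
import Mathlib.RingTheory.TensorProduct.Free
import Mathlib.FieldTheory.IntermediateField.Adjoin.Defs
import Literature.NumberTheory.GaloisRepresentations.GaloisRep
import Literature.NumberTheory.GaloisRepresentations.PAdicHodge
import Literature.NumberTheory.GaloisRepresentations.PAdicHodgeProofs
import HarnessLib

/-!
# Potential diagonalizability of `p`-adic Galois representations (Barnet-Lamb–Gee–Geraghty–Taylor)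

Ledger item `defn-IsPotentiallyDiagonalizable` (topic `Literature/NumberTheory/GaloisRepresentations`),
wanted by route `Langlands/WachCensus` (items `PD2Unram`, `PDCalculusFacts`, `PDLiftingGL2`) and by every
lifting route that consumes the Barnet-Lamb–Gee–Geraghty–Taylor (BLGGT) change-of-weight theorems.

## The printed definitions (BLGGT, *Potential automorphy and change of weight*, §1.4, "Local theory: `l = p`")

`K/ℚ_p` finite, `𝒪` the integers of a sufficiently large finite `E/ℚ_p` inside `ℚ̄_p`, residue field `𝔽`.
For continuous `ρ₁ ρ₂ : G_K → GL_n(𝒪_{ℚ̄_p})`, **`ρ₁` connects to `ρ₂`** (`ρ₁ ~ ρ₂`) iff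
(i) the reductions `ρ̄₁`, `ρ̄₂` are equivalent; (ii) `ρ₁`, `ρ₂` are both potentially crystalline;
(iii) `HT_τ(ρ₁) = HT_τ(ρ₂)` for every `τ : K ↪ ℚ̄_p`; (iv) `ρ₁` and `ρ₂` define points on the same
irreducible component of `Spec (R^□_{ρ̄₁, {HT_τ(ρ₁)}, K'-cris} ⊗ ℚ̄_p)` for some (hence all) sufficiently large
finite `K'/K`, where `R^□_{𝒪, ρ̄, {H_τ}, K'-cris}` is Kisin's reduced `p`-torsion-free quotient of the universal
framed deformation (lifting) ring `R^□_{𝒪, ρ̄}` whose `ℚ̄_p`-points are exactly the lifts which are crystalline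
after restriction to `G_{K'}` with labelled Hodge–Tate weights `{H_τ}` (Kisin 2008, Thm. (2.7.6),
Cor. (2.7.7), §(3.3.3); BLGGT §1.4).  `ρ : G_K → GL_n(𝒪_{ℚ̄_p})` is **diagonalizable** iff it is crystalline
and connects to some `χ₁ ⊕ ⋯ ⊕ χ_n` with `χ_i : G_K → 𝒪_{ℚ̄_p}^×` crystalline characters, and **potentially
diagonalizable** iff `ρ|_{G_{K'}}` is diagonalizable for some finite `K'/K`.  By BLGGT Lemma 1.4.1 potential
diagonalizability of `ρ : G_K → GL_n(ℚ̄_p)` does not depend on the choice of an invariant lattice.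

## Main definitions

* `Literature.NumberTheory.GaloisRepresentations.CrystallineExtensionData p K`: crystalline period-ring data
  (`CrystallinePeriodRingData`, file `PAdicHodge`, intended: Fontaine's `B_cris`) for every finite extension
  `K'` of `K` inside `AlgebraicClosure K` — the datum all notions below are relative to (same pattern as
  `GaloisRep.IsGeometric` / `Literature.NumberTheory.Automorphic.DeRhamData`).
* `ConnectingFamily p Γ n`: a representation `Γ → GL_n(A)` of a topological group over a complete
  noetherian local `𝒪_E`-algebra `A` which is a *domain* with residue field `k_E` (`E/ℚ_p` finite inside
  `ℚ̄_p`), continuous for the `𝔪_A`-adic topology, together with two `𝒪_E`-rational points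
  `left right : A → 𝒪_E`; `ConnectingFamily.PointsSatisfy` ("every `𝒪_E`-algebra point `A → ℚ̄_p` of the
  family has property `P`"), `leftFn`, `rightFn` (the two specialisations, as matrix-valued functions).
* `IsCrystallineFn 𝔅 f`: every model over a finite `E'/ℚ_p` of the matrix-valued function
  `f : Γ_L → M_n(ℚ̄_p)` is crystalline relative to `𝔅` (as a `ℚ_p`-linear representation,
  `FramedRep.restrictScalars`).
* `ConnectsOver 𝔅 K' ρ₁ ρ₂` (BLGGT `ρ₁ ~ ρ₂` for integral framed representations of `Γ_{K'}`),
  `IsDiagonalizableOver 𝔅 K' hK' ρ`, and for representations of `Γ_K` itself the abbreviations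
  `Connects 𝔅 ρ₁ ρ₂`, `IsDiagonalizable 𝔅 ρ` (base field `= ⊥`), and the requested predicate
  `IsPotentiallyDiagonalizable 𝔅 ρ` for `ρ : FramedGaloisRep K (PadicAlgCl p) n`.
* API: `isPotentiallyDiagonalizable_conj_iff` (the formal shadow of BLGGT Lemma 1.4.1: invariance under
  `GL_n(ℚ̄_p)`-conjugation), `IsDiagonalizableOver.isPotentiallyDiagonalizable`,
  `IsDiagonalizable.isPotentiallyDiagonalizable`, and the non-vacuity theorem
  `isPotentiallyDiagonalizable_one` (the trivial representation is potentially diagonalizable for *every*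
  datum), built from `ConnectingFamily.trivial` (the constant family over `ℤ_p`) and
  `PeriodRingData.isAdmissible_of_forall_apply_eq` (a representation with trivial action is `B`-admissible
  for every period-ring datum — equality in Fontaine's inequality `PeriodRingData.finrank_D_le_holds`).

## The reformulation of (iv) used here, and why it is faithful

Neither Mathlib nor the tree has Galois deformation rings (ledger item `defn-CrystallineDeformationRing` is
separate and open).  They are not needed to *define* `~` faithfully: every proof of an instance of `~` in BLGGT
(§1.2 Lemma 1.2.1, the filtration remark of §1.3/§1.4, Lemma 1.4.1) exhibits a **family** — a continuous
representation `ρ̃ : G_K → GL_n(A)` over a complete noetherian local `𝒪`-algebra `A` which is a domain with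
residue field `𝔽`, two `𝒪`-points of which are `ρ₁` and `ρ₂` — and concludes by the universal property of
`R^□_{𝒪,ρ̄}` ("As `A⁰` is a domain ... the points ... lie on the same irreducible component", proof of
Lemma 1.2.1).  Precisely, for continuous `ρ₁ ρ₂ : G_K → GL_n(𝒪_{ℚ̄_p})`:

  `ρ₁ ~ ρ₂` **iff** there are a finite `K'/K`, a finite `E/ℚ_p` in `ℚ̄_p`, a complete noetherian local
  `𝒪_E`-algebra `A` which is a domain with residue field `k_E`, a continuous `ρ̃ : G_K → GL_n(A)`,
  `𝒪_E`-algebra maps `x₁ x₂ : A → 𝒪_E` and `g ∈ GL_n(𝒪_{ℚ̄_p})` with `x₁(ρ̃) = ρ₁`, `x₂(ρ̃) = g ρ₂ g⁻¹`, such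
  that for every `𝒪_E`-algebra map `y : A → ℚ̄_p` the representation `y(ρ̃)|_{G_{K'}}` is crystalline.

(⇐) `ρ̃` reduces to a fixed `ρ̄ : G_K → GL_n(k_E)` and is classified by a local `𝒪_E`-map `φ : R^□_{𝒪_E,ρ̄} → A`.
Every `𝒪_E`-point of `A` lands in a finite extension of `E` and is `K'`-crystalline; the labelled Hodge–Tate
weights of these points are bounded (`A` is finite over some `𝒪_E⟦x₁,…,x_d⟧`, and the closed points of
`Spec 𝒪_E⟦x⟧[1/p]` — Galois orbits of the open unit polydisc — are not a countable union of proper Zariski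
closed subsets) hence, by Kisin 2008 Thm. (2.5.5) and Cor. (2.6.2) (the `p`-adic Hodge type is locally
constant on the potentially semistable locus) and connectedness of `Spec A[1/p]`, *constant*, equal to
`{HT_τ(ρ₁)}`: this gives (ii) and (iii).  Since `A[1/p]` is Jacobson with closed points rational over finite
extensions of `E` (BLGGT §1.2, citing Taylor, *Automorphy for some `l`-adic lifts II*, Lemma 2.6) and `A` is
a `p`-torsion-free domain, `φ` kills the kernel of `R^□ → R^□_{𝒪_E,ρ̄,{HT_τ(ρ₁)},K'-cris}` (Kisin's
characterisation of that reduced quotient by its points, Thm. (2.7.6)/Cor. (2.7.7)), so `ρ₁` and `gρ₂g⁻¹` lie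
on one irreducible component of `Spec R^□_{…,K'-cris}[1/p]`; being `E`-rational they lie on a common
irreducible component of `Spec (R^□_{…,K'-cris} ⊗ ℚ̄_p)` (an `E`-rational point of an integral `E`-scheme
lies on every geometric component, these being permuted transitively by `Gal(ℚ̄_p/E)`), i.e. (iv); (i) holds
because both endpoints reduce to `ρ̄`; finally `~` is insensitive to `GL_n(𝒪_{ℚ̄_p})`-conjugation (BLGGT §1.4,
first remark).  (⇒) Conjugate `ρ₂` by `g ∈ GL_n(𝒪)` so that `ρ̄₁ = ρ̄₂`, enlarge `E` so that `ρ₁`, `gρ₂g⁻¹` are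
`𝒪_E`-valued and the common geometric component `C` is defined over `E`, and take `A := R^□_{…,K'-cris}/𝔭_C`
with the push-forward of the universal framed lift: a complete noetherian local domain with residue field
`k_E`, through which both points factor, all of whose `ℚ̄_p`-points are `K'`-crystalline.

Two details of the reformulation are forced by faithfulness: the residue field of `A` must be `k_E` and the two
endpoints must be `𝒪_E`-*rational* (`left right : A → 𝒪_E`), since otherwise Frobenius-twisted or
`Gal(E'/E)`-conjugate points — which may lie on different geometric components — would be declared connected.

## Design choices

* **Relative to period-ring data**, exactly like `GaloisRep.IsCrystalline` (file `PAdicHodge`): "crystalline"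
  is `B`-admissibility for a supplied `CrystallinePeriodRingData`; here one datum is needed for every finite
  `K'/K`, indexed by `IntermediateField K (AlgebraicClosure K)` (`CrystallineExtensionData`).  The base field
  itself is the bottom intermediate field `⊥ ≃ K`; all identifications `Γ_{K'} → Γ_K` are the tree's
  `absGaloisRestrict` (canonical up to inner automorphisms, under which every notion here is invariant).
* **Coefficients.** `ℚ̄_p = PadicAlgCl p`; `𝒪_E = padicCoeffRing E` for `E : IntermediateField ℚ_[p] (PadicAlgCl p)`;
  a `ℚ̄_p`-point of `A` is a ring map `y : A →+* PadicAlgCl p` with `y ∘ (𝒪_E → A) = (𝒪_E ⊆ ℚ̄_p)`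
  (`ConnectingFamily.IsPoint`); it automatically lands in a finite extension of `E` and is continuous.
  Crystallinity of a `ℚ̄_p`-valued representation is tested on its models over finite `E'/ℚ_p`
  (`IsCrystallineFn`; Fontaine's theory is `ℚ_p`-linear, `FramedRep.restrictScalars`, cf.
  `Literature.NumberTheory.Automorphic.restrictScalarsQl`, which is the same construction for Galois groups but
  lives in the automorphic cone and is not imported here).  A continuous `ρ : Γ → GL_n(ℚ̄_p)` of a compact
  group has an exact model over some finite `E'` (Baire), so the test is never vacuous.
* **Continuity of families** is stated without topologising `A`: the congruence kernels
  `{σ | ρ̃ σ ≡ 1 mod 𝔪_A^k}` are open for all `k` (`ConnectingFamily.isOpen_setOf_congr`), which for a group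
  homomorphism into `GL_n` of an `𝔪_A`-adically separated complete ring is continuity.
* **Lattices.** BLGGT's `~` is a relation on `𝒪_{ℚ̄_p}`-valued representations; here representations are
  `ℚ̄_p`-valued (`FramedGaloisRep K' (PadicAlgCl p) n`) and integrality is forced by the family (`leftFn` has
  entries in `𝒪_E`), so `ConnectsOver` is (correctly) false off integral `ρ₁`; the conjugating `g` is required
  to lie in `GL_n(𝒪_{ℚ̄_p})` (`IsPadicIntegralGL`).  In `IsPotentiallyDiagonalizable` the lattice is chosen by an
  arbitrary `g ∈ GL_n(ℚ̄_p)` (BLGGT Lemma 1.4.1: the notion is lattice independent), which makes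
  `isPotentiallyDiagonalizable_conj_iff` a triviality.
* **The diagonal endpoint** of `IsDiagonalizableOver` is any `δ : Γ_{K'} →ₜ* GL_n(ℚ̄_p)` with diagonal values
  which is crystalline: its diagonal entries are then continuous characters `χ_i` (valued in `𝒪_{ℚ̄_p}^×` by
  compactness) and `δ = χ₁ ⊕ ⋯ ⊕ χ_n` is crystalline iff every `χ_i` is.
* **Universes.** `A : Type` (every complete noetherian local `𝒪_E`-algebra with residue field `k_E` is a
  quotient of some `𝒪_E⟦x₁,…,x_m⟧`, Cohen); `K : Type u`; period rings in `Type w`.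
* Mathlib declarations used: `PadicAlgCl`, `PadicInt`, `Valued.v`, `Valuation.integer`, `IntermediateField`,
  `IntermediateField.botEquiv`, `IntermediateField.inclusion`, `IsLocalRing`, `IsLocalRing.residue`,
  `IsAdicComplete`, `IsNoetherianRing`, `Matrix.GeneralLinearGroup`, `Algebra.TensorProduct.basis`,
  `LinearIndependent.restrict_scalars`, `Module.rank_lt_aleph0_iff`.  Mathlib has no deformation rings, no
  `B_cris`, no potential diagonalizability (grep `Diagonalizable`, `deformation` in `Mathlib/NumberTheory`,
  `Mathlib/RepresentationTheory`: nothing relevant).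

## Deliberately NOT here

* Kisin's rings `R^□_{ρ̄,{H_τ},K'-cris}` themselves and the theorem "`ConnectsOver` ⇔ common irreducible
  component" (ledger item `defn-CrystallineDeformationRing`); labelled Hodge–Tate weights (the tree's
  `PeriodRingData.hodgeTateWeights` is unlabelled; condition (iii) is automatic in the family formulation).
* The named facts of BLGGT §1.4 (`~` is an equivalence relation — Kisin 2008 Thm. (3.3.8); compatibility with
  restriction, sums, tensor products, duals, unramified twists, filtrations; Lemma 1.4.3; the known ranges
  Fontaine–Laffaille / Gao–Liu / Bartlett / Gee–Kisin): they are statable with `ConnectsOver`,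
  `IsDiagonalizableOver`, `IsPotentiallyDiagonalizable` and are the business of the route's cite items.

## References

* T. Barnet-Lamb, T. Gee, D. Geraghty, R. Taylor, *Potential automorphy and change of weight*, Ann. of Math.
  179 (2014), §1.2 (Lemma 1.2.1), §1.4 (pp. 14–15 of arXiv:1010.2561: `~`, diagonalizable, potentially
  diagonalizable, Lemma 1.4.1). [BarnetlambEtAl2014]
* M. Kisin, *Potentially semi-stable deformation rings*, J. Amer. Math. Soc. 21 (2008), Thm. (2.5.5),
  Cor. (2.6.2), Thm. (2.7.6), Cor. (2.7.7), §(3.3.3), Thm. (3.3.8). [Kisin2007]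
* J.-M. Fontaine, Astérisque 223 (1994), Exposé III §1.5 (`B`-admissible representations; sub-objects).
-/

noncomputable section

open scoped Matrix
open Field

namespace Literature.NumberTheory.GaloisRepresentations

universe u v w

/-! ### Coefficient rings inside `ℚ̄_p` -/

section Coeff

variable {p : ℕ} [Fact p.Prime]

/-- The **ring of integers `𝒪_E`** of a subfield `ℚ_p ⊆ E ⊆ ℚ̄_p = PadicAlgCl p`, as a subring of `E`: the
elements of valuation `≤ 1` for the valuation of `ℚ̄_p` (Mathlib `PadicAlgCl.valued`, `Valuation.integer`,
pulled back along `E ⊆ ℚ̄_p`).  For `E/ℚ_p` finite this is the valuation ring of `E`, a complete discrete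
valuation ring with finite residue field `k_E`. [folklore] -/
def padicCoeffRing (E : IntermediateField ℚ_[p] (PadicAlgCl p)) : Subring E :=
  (Valued.v (R := PadicAlgCl p)).integer.comap (algebraMap E (PadicAlgCl p))

/-- Membership in `𝒪_E`: norm at most `1` in `ℚ̄_p`. [folklore] -/
lemma mem_padicCoeffRing_iff (E : IntermediateField ℚ_[p] (PadicAlgCl p)) (x : E) :
    x ∈ padicCoeffRing E ↔ ‖(x : PadicAlgCl p)‖ ≤ 1 := by
  simp only [padicCoeffRing, Subring.mem_comap, Valuation.mem_integer_iff,
    PadicAlgCl.valuation_def]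
  rw [← NNReal.coe_le_coe, coe_nnnorm, NNReal.coe_one]
  rfl

/-- The inclusion `𝒪_E ⊆ E ⊆ ℚ̄_p` as a ring homomorphism. [folklore] -/
def padicCoeffRingToPadicAlgCl (E : IntermediateField ℚ_[p] (PadicAlgCl p)) :
    padicCoeffRing E →+* PadicAlgCl p :=
  (algebraMap E (PadicAlgCl p)).comp (padicCoeffRing E).subtype

/-- Unfolding lemma for `padicCoeffRingToPadicAlgCl`. [folklore] -/
@[simp] lemma padicCoeffRingToPadicAlgCl_apply (E : IntermediateField ℚ_[p] (PadicAlgCl p))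
    (x : padicCoeffRing E) : padicCoeffRingToPadicAlgCl E x = ((x : E) : PadicAlgCl p) := rfl

/-- `g ∈ GL_n(ℚ̄_p)` **lies in `GL_n(𝒪_{ℚ̄_p})`**: `g` and `g⁻¹` have entries of norm `≤ 1`.  (BLGGT's relation
`~` is invariant under conjugation by such `g`, §1.4, first remark.) [folklore] -/
def IsPadicIntegralGL {n : ℕ} (g : GL (Fin n) (PadicAlgCl p)) : Prop :=
  ∀ i j, ‖(g : Matrix (Fin n) (Fin n) (PadicAlgCl p)) i j‖ ≤ 1 ∧
    ‖((g⁻¹ : GL (Fin n) (PadicAlgCl p)) : Matrix (Fin n) (Fin n) (PadicAlgCl p)) i j‖ ≤ 1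

end Coeff

/-! ### Matrix-valued functions and restriction of scalars of framed representations -/

section RestrictScalars

variable {G : Type u} [Group G] [TopologicalSpace G] {A : Type v} [CommRing A] [TopologicalSpace A]
  {n : ℕ}

/-- The matrix-valued function `g ↦ ρ(g) ∈ M_n(A)` underlying a framed representation. [folklore] -/
def FramedRep.matrixFn (ρ : FramedRep G A n) : G → Matrix (Fin n) (Fin n) A :=
  fun g => ((ρ g : GL (Fin n) A) : Matrix (Fin n) (Fin n) A)

/-- Unfolding lemma for `FramedRep.matrixFn`. [folklore] -/
@[simp] lemma FramedRep.matrixFn_apply (ρ : FramedRep G A n) (g : G) :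
    ρ.matrixFn g = ((ρ g : GL (Fin n) A) : Matrix (Fin n) (Fin n) A) := rfl

variable [IsTopologicalRing A]

/-- **Restriction of scalars** of a framed representation `ρ : G →ₜ* GL_n(A)` along an algebra
`P → A`: the `P`-linear continuous representation on `Fin n → A` with the same maps and the same (product)
topology (for `A = E ⊆ ℚ̄_p` finite over `P = ℚ_p` this is the `ℚ_p`-linear representation to which
Fontaine's formalism applies; same construction as `Literature.NumberTheory.Automorphic.restrictScalarsQl`).
Ref: Fontaine, Astérisque 223 (1994), Exposé III §1; Buzzard–Gee 2014, §2.2. [folklore] -/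
def FramedRep.restrictScalars (P : Type*) [CommRing P] [TopologicalSpace P] [Algebra P A]
    (ρ : FramedRep G A n) : ContinuousRep G P (Fin n → A) where
  toRepresentation :=
    { toFun := fun g => (ρ.toRepresentation g).restrictScalars P
      map_one' := LinearMap.ext fun x => by simp
      map_mul' := fun g h => LinearMap.ext fun x => by simp }
  continuous_smul := ρ.toContinuousRep.continuous_smul

/-- Unfolding lemma for `FramedRep.restrictScalars`: the action is `v ↦ ρ(g) v`. [folklore] -/
@[simp] lemma FramedRep.restrictScalars_apply_apply (P : Type*) [CommRing P] [TopologicalSpace P]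
    [Algebra P A] (ρ : FramedRep G A n) (g : G) (x : Fin n → A) :
    ρ.restrictScalars P g x = ((ρ g : GL (Fin n) A) : Matrix (Fin n) (Fin n) A) *ᵥ x := rfl

end RestrictScalars

/-! ### Families over complete noetherian local domains -/

/-- A **connecting family** of rank-`n` representations of the topological group `Γ` (the device by which
BLGGT prove every instance of `ρ₁ ~ ρ₂`, §1.2 proof of Lemma 1.2.1, §1.4 proof of Lemma 1.4.1): a finite
extension `E` of `ℚ_p` inside `ℚ̄_p`; a complete noetherian local ring `A` which is a **domain**, with an
`𝒪_E`-algebra structure `structureMap : 𝒪_E → A` inducing a surjection onto the residue field of `A`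
(so `A` has residue field `k_E`); a homomorphism `rep : Γ → GL_n(A)` continuous for the `𝔪_A`-adic topology
(`isOpen_setOf_congr`: every congruence kernel `{σ | rep σ ≡ 1 mod 𝔪_A^k}` is open); and two
`𝒪_E`-rational points `left right : A → 𝒪_E` (sections of `structureMap`).  The irreducible components of the
generic fibre of Kisin's crystalline deformation rings give such families (`A = R/𝔭`), and conversely (module
docstring).  `A` is taken in `Type`: every such ring is a quotient of some `𝒪_E⟦x₁,…,x_m⟧`.
[cite: BarnetlambEtAl2014, §1.2 Lemma 1.2.1 and §1.4] -/
structure ConnectingFamily (p : ℕ) [Fact p.Prime] (Γ : Type u) [Group Γ] [TopologicalSpace Γ]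
    (n : ℕ) : Type (max u 1) where
  /-- The coefficient field `E`, `ℚ_p ⊆ E ⊆ ℚ̄_p`. -/
  E : IntermediateField ℚ_[p] (PadicAlgCl p)
  /-- `E/ℚ_p` is finite. -/
  finiteDimensional : FiniteDimensional ℚ_[p] E
  /-- The base ring `A` of the family. -/
  A : Type
  /-- `A` is a commutative ring, -/
  [commRing : CommRing A]
  /-- a domain, -/
  [isDomain : IsDomain A]
  /-- noetherian, -/
  [isNoetherianRing : IsNoetherianRing A]
  /-- local, -/
  [isLocalRing : IsLocalRing A]
  /-- and `𝔪_A`-adically complete and separated. -/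
  [isAdicComplete : IsAdicComplete (IsLocalRing.maximalIdeal A) A]
  /-- The `𝒪_E`-algebra structure `𝒪_E → A`. -/
  structureMap : padicCoeffRing E →+* A
  /-- `A` has residue field `k_E`: `𝒪_E → A → A/𝔪_A` is surjective. -/
  residue_comp_surjective : Function.Surjective ((IsLocalRing.residue A).comp structureMap)
  /-- The family: a representation `Γ → GL_n(A)`. -/
  rep : Γ →* GL (Fin n) A
  /-- Continuity for the `𝔪_A`-adic topology: the congruence kernels are open. -/
  isOpen_setOf_congr : ∀ k : ℕ, IsOpen {σ : Γ | ∀ i j,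
    (((rep σ : GL (Fin n) A) : Matrix (Fin n) (Fin n) A) - 1) i j ∈ IsLocalRing.maximalIdeal A ^ k}
  /-- The first `𝒪_E`-rational point. -/
  left : A →+* padicCoeffRing E
  /-- The second `𝒪_E`-rational point. -/
  right : A →+* padicCoeffRing E
  /-- `left` is a section of the structure map (an `𝒪_E`-algebra map). -/
  left_comp : left.comp structureMap = RingHom.id _
  /-- `right` is a section of the structure map (an `𝒪_E`-algebra map). -/
  right_comp : right.comp structureMap = RingHom.id _

namespace ConnectingFamily

attribute [instance] commRing isDomain isNoetherianRing isLocalRing isAdicComplete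

variable {p : ℕ} [Fact p.Prime] {Γ : Type u} [Group Γ] [TopologicalSpace Γ] {n : ℕ}
  (𝓕 : ConnectingFamily p Γ n)

/-- The **specialisation** of the family at a ring map `y : A → ℚ̄_p`: the matrix-valued function
`σ ↦ y(rep σ)`. [cite: BarnetlambEtAl2014, §1.2] -/
def specialize (y : 𝓕.A →+* PadicAlgCl p) : Γ → Matrix (Fin n) (Fin n) (PadicAlgCl p) :=
  fun σ => ((𝓕.rep σ : GL (Fin n) 𝓕.A) : Matrix (Fin n) (Fin n) 𝓕.A).map y

/-- `y : A → ℚ̄_p` is a **`ℚ̄_p`-point** of the family: an `𝒪_E`-algebra homomorphism, i.e. it restricts to the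
inclusion on `𝒪_E` (such a map lands in a finite extension of `E` and is continuous).
[cite: BarnetlambEtAl2014, §1.2] -/
def IsPoint (y : 𝓕.A →+* PadicAlgCl p) : Prop :=
  y.comp 𝓕.structureMap = padicCoeffRingToPadicAlgCl 𝓕.E

/-- The first endpoint as a `ℚ̄_p`-point `A → 𝒪_E ⊆ ℚ̄_p`. [folklore] -/
def leftPoint : 𝓕.A →+* PadicAlgCl p := (padicCoeffRingToPadicAlgCl 𝓕.E).comp 𝓕.left

/-- The second endpoint as a `ℚ̄_p`-point `A → 𝒪_E ⊆ ℚ̄_p`. [folklore] -/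
def rightPoint : 𝓕.A →+* PadicAlgCl p := (padicCoeffRingToPadicAlgCl 𝓕.E).comp 𝓕.right

/-- The first endpoint is a point. [folklore] -/
lemma isPoint_leftPoint : 𝓕.IsPoint 𝓕.leftPoint := by
  rw [IsPoint, leftPoint, RingHom.comp_assoc, 𝓕.left_comp, RingHom.comp_id]

/-- The second endpoint is a point. [folklore] -/
lemma isPoint_rightPoint : 𝓕.IsPoint 𝓕.rightPoint := by
  rw [IsPoint, rightPoint, RingHom.comp_assoc, 𝓕.right_comp, RingHom.comp_id]

/-- The representation `Γ → M_n(ℚ̄_p)` at the first endpoint (as a matrix-valued function). [folklore] -/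
def leftFn : Γ → Matrix (Fin n) (Fin n) (PadicAlgCl p) := 𝓕.specialize 𝓕.leftPoint

/-- The representation `Γ → M_n(ℚ̄_p)` at the second endpoint (as a matrix-valued function). [folklore] -/
def rightFn : Γ → Matrix (Fin n) (Fin n) (PadicAlgCl p) := 𝓕.specialize 𝓕.rightPoint

/-- **Every `ℚ̄_p`-point of the family has property `P`** (applied to its specialisation).  With
`P =` "crystalline after restriction to `G_{K'}`" this is BLGGT's condition that the family lie in
`Spec R^□_{ρ̄, K'-cris}` (Kisin's quotient is characterised by its `ℚ̄_p`-points).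
[cite: BarnetlambEtAl2014, §1.4] -/
def PointsSatisfy (P : (Γ → Matrix (Fin n) (Fin n) (PadicAlgCl p)) → Prop) : Prop :=
  ∀ y : 𝓕.A →+* PadicAlgCl p, 𝓕.IsPoint y → P (𝓕.specialize y)

/-- In particular the first endpoint has property `P`. [folklore] -/
lemma PointsSatisfy.leftFn {P : (Γ → Matrix (Fin n) (Fin n) (PadicAlgCl p)) → Prop}
    (h : 𝓕.PointsSatisfy P) : P 𝓕.leftFn := h _ 𝓕.isPoint_leftPoint

/-- In particular the second endpoint has property `P`. [folklore] -/
lemma PointsSatisfy.rightFn {P : (Γ → Matrix (Fin n) (Fin n) (PadicAlgCl p)) → Prop}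
    (h : 𝓕.PointsSatisfy P) : P 𝓕.rightFn := h _ 𝓕.isPoint_rightPoint

/-- `PointsSatisfy` is monotone in the property. [folklore] -/
lemma PointsSatisfy.mono {P Q : (Γ → Matrix (Fin n) (Fin n) (PadicAlgCl p)) → Prop}
    (hPQ : ∀ f, P f → Q f) (h : 𝓕.PointsSatisfy P) : 𝓕.PointsSatisfy Q :=
  fun y hy => hPQ _ (h y hy)

end ConnectingFamily

/-! ### Connects, diagonalizable, potentially diagonalizable -/

section Crystalline

variable {p : ℕ} [Fact p.Prime]

/-- A matrix-valued function `f : Γ_L → M_n(ℚ̄_p)` **is crystalline** relative to the crystalline period-ring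
datum `𝔅` for `L` (intended: `B_cris(L)`): every continuous model `r : Γ_L →ₜ* GL_n(E')` of `f` over a finite
`E'/ℚ_p` inside `ℚ̄_p` (`r`, pushed into `ℚ̄_p`, equals `f`) is crystalline as a `ℚ_p`-linear representation
(`FramedRep.restrictScalars`, `GaloisRep.IsCrystalline`).  For `f` the function of a continuous
`ρ : Γ_L →ₜ* GL_n(ℚ̄_p)` a model exists (compactness and Baire), and crystallinity does not depend on the model.
Ref: Fontaine, Astérisque 223 (1994), Exposé III §5.1; Buzzard–Gee 2014, §2.2 (coefficients). [folklore] -/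
def IsCrystallineFn {L : Type u} [Field L] [Algebra ℚ_[p] L]
    (𝔅 : CrystallinePeriodRingData.{0, u, w} ℚ_[p] L) {n : ℕ}
    (f : absoluteGaloisGroup L → Matrix (Fin n) (Fin n) (PadicAlgCl p)) : Prop :=
  ∀ (E' : IntermediateField ℚ_[p] (PadicAlgCl p)) (_ : FiniteDimensional ℚ_[p] E')
    (r : FramedGaloisRep L E' n),
    (∀ σ, (r.matrixFn σ).map (algebraMap E' (PadicAlgCl p)) = f σ) →
      GaloisRep.IsCrystalline 𝔅 (FramedRep.restrictScalars ℚ_[p] r)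

/-- **Crystalline period-ring data along the finite extensions of `K`**: for every finite extension `K'` of
`K` inside `AlgebraicClosure K` a crystalline period-ring datum for `K'` over `ℚ_p` (file `PAdicHodge`;
intended instance: Fontaine's `B_cris` with `F₀ = K'₀`).  The base field is the bottom field `⊥ ≃ K`.  This is
the parameter of all the notions of this file (cf. `Literature.NumberTheory.Automorphic.DeRhamData`).
Ref: Fontaine, Astérisque 223 (1994), Exposé III §5.1. [folklore] -/
abbrev CrystallineExtensionData (p : ℕ) [Fact p.Prime] (K : Type u) [Field K] [Algebra ℚ_[p] K] :
    Type (max u (w + 1)) :=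
  ∀ K' : IntermediateField K (AlgebraicClosure K), FiniteDimensional K K' →
    CrystallinePeriodRingData.{0, u, w} ℚ_[p] K'

variable {K : Type u} [Field K] [Algebra ℚ_[p] K] {n : ℕ}

/-- **`ρ₁` connects to `ρ₂`** (`ρ₁ ~ ρ₂`, BLGGT §1.4, case `l = p`) for continuous representations
`ρ₁ ρ₂ : Γ_{K'} → GL_n(ℚ̄_p)` of the absolute Galois group of a finite extension `K'` of `K` inside `K̄`
(intended: `K/ℚ_p` finite, `ρ₁` integral), in the family form of the module docstring: there are a finite
extension `K'' ⊇ K'` of `K`, a connecting family `𝓕` of representations of `Γ_{K'}` and `g ∈ GL_n(𝒪_{ℚ̄_p})`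
such that the first endpoint of `𝓕` is `ρ₁`, the second is `g ρ₂ g⁻¹`, and every `ℚ̄_p`-point of `𝓕` is
crystalline after restriction to `Γ_{K''}` (relative to `𝔅 K''`).  Printed definition: (i) equivalent
reductions, (ii) both potentially crystalline, (iii) equal labelled Hodge–Tate weights, (iv) points on a
common irreducible component of `Spec (R^□_{ρ̄₁,{HT_τ(ρ₁)},K''-cris} ⊗ ℚ̄_p)` for `K''` large; (i)–(iii)
follow from the family condition and (iv) is equivalent to it (Kisin 2008, Thm. (2.7.6), Cor. (2.7.7),
Cor. (2.6.2); BLGGT §1.2).  False (no family exists) unless `ρ₁` has entries in some `𝒪_E`, matching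
BLGGT's restriction to `𝒪_{ℚ̄_p}`-valued representations. [cite: BarnetlambEtAl2014, §1.4] -/
def ConnectsOver (𝔅 : CrystallineExtensionData.{u, w} p K)
    (K' : IntermediateField K (AlgebraicClosure K))
    (ρ₁ ρ₂ : FramedGaloisRep K' (PadicAlgCl p) n) : Prop :=
  ∃ (K'' : IntermediateField K (AlgebraicClosure K)) (hle : K' ≤ K'')
    (hK'' : FiniteDimensional K K'') (𝓕 : ConnectingFamily p (absoluteGaloisGroup K') n)
    (g : GL (Fin n) (PadicAlgCl p)),
    IsPadicIntegralGL g ∧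
    𝓕.leftFn = ρ₁.matrixFn ∧
    𝓕.rightFn = (FramedRep.conj g ρ₂).matrixFn ∧
    𝓕.PointsSatisfy fun f =>
      letI : Algebra K' K'' := (IntermediateField.inclusion hle).toRingHom.toAlgebra
      IsCrystallineFn (𝔅 K'' hK'') (f ∘ absGaloisRestrict K' K'')

/-- **`ρ` is diagonalizable** (BLGGT §1.4) for a continuous `ρ : Γ_{K'} → GL_n(ℚ̄_p)`, `K'` a finite
extension of `K` inside `K̄`: `ρ` is crystalline (relative to `𝔅 K'`) and connects (`ConnectsOver`) to a
representation `δ = χ₁ ⊕ ⋯ ⊕ χ_n` with diagonal values which is crystalline, i.e. whose diagonal entries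
`χ_i : Γ_{K'} → 𝒪_{ℚ̄_p}^×` are crystalline characters. [cite: BarnetlambEtAl2014, §1.4] -/
def IsDiagonalizableOver (𝔅 : CrystallineExtensionData.{u, w} p K)
    (K' : IntermediateField K (AlgebraicClosure K)) (hK' : FiniteDimensional K K')
    (ρ : FramedGaloisRep K' (PadicAlgCl p) n) : Prop :=
  IsCrystallineFn (𝔅 K' hK') ρ.matrixFn ∧
    ∃ δ : FramedGaloisRep K' (PadicAlgCl p) n,
      (∀ σ i j, i ≠ j → δ.matrixFn σ i j = 0) ∧
      IsCrystallineFn (𝔅 K' hK') δ.matrixFn ∧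
      ConnectsOver 𝔅 K' ρ δ

/-- **`ρ` is potentially diagonalizable** (BLGGT §1.4, with Lemma 1.4.1) for a continuous
`ρ : Γ_K → GL_n(ℚ̄_p)` (intended: `K/ℚ_p` finite): for some finite extension `K'` of `K` inside `K̄` and some
`g ∈ GL_n(ℚ̄_p)` (a choice of `Γ_{K'}`-invariant lattice — by BLGGT Lemma 1.4.1 the notion does not depend on
it; non-lattice choices make `IsDiagonalizableOver` false) the representation `g ρ|_{Γ_{K'}} g⁻¹` is
diagonalizable.  This is the hypothesis "`r|_{G_{F_v}}` potentially diagonalizable" of the BLGGT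
automorphy-lifting and change-of-weight theorems (Thm. 4.2.1 ff.). [cite: BarnetlambEtAl2014, §1.4] -/
def IsPotentiallyDiagonalizable (𝔅 : CrystallineExtensionData.{u, w} p K)
    (ρ : FramedGaloisRep K (PadicAlgCl p) n) : Prop :=
  ∃ (K' : IntermediateField K (AlgebraicClosure K)) (hK' : FiniteDimensional K K')
    (g : GL (Fin n) (PadicAlgCl p)),
    IsDiagonalizableOver 𝔅 K' hK' (FramedRep.conj g (ρ.restrictField K'))

/-- **`ρ₁ ~ ρ₂`** for representations of `Γ_K` itself: `ConnectsOver` over the bottom field `⊥ ≃ K` of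
`K̄/K`, applied to the restrictions along `absGaloisRestrict K ⊥ : Γ_⊥ → Γ_K` (an isomorphism up to the
choices, under which the notion is invariant). [cite: BarnetlambEtAl2014, §1.4] -/
abbrev Connects (𝔅 : CrystallineExtensionData.{u, w} p K)
    (ρ₁ ρ₂ : FramedGaloisRep K (PadicAlgCl p) n) : Prop :=
  ConnectsOver 𝔅 ⊥ (ρ₁.restrictField (⊥ : IntermediateField K (AlgebraicClosure K)))
    (ρ₂.restrictField (⊥ : IntermediateField K (AlgebraicClosure K)))

/-- **`ρ` is diagonalizable** for a representation of `Γ_K` itself: `IsDiagonalizableOver` over the bottom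
field `⊥ ≃ K`. [cite: BarnetlambEtAl2014, §1.4] -/
abbrev IsDiagonalizable (𝔅 : CrystallineExtensionData.{u, w} p K)
    (ρ : FramedGaloisRep K (PadicAlgCl p) n) : Prop :=
  IsDiagonalizableOver 𝔅 ⊥ inferInstance
    (ρ.restrictField (⊥ : IntermediateField K (AlgebraicClosure K)))

/-- **BLGGT Lemma 1.4.1, formal shadow**: potential diagonalizability is invariant under
`GL_n(ℚ̄_p)`-conjugation (here a triviality, the lattice choice `g` being part of the definition).
[cite: BarnetlambEtAl2014, §1.4 Lemma 1.4.1] -/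
theorem isPotentiallyDiagonalizable_conj_iff (𝔅 : CrystallineExtensionData.{u, w} p K)
    (ρ : FramedGaloisRep K (PadicAlgCl p) n) (P : GL (Fin n) (PadicAlgCl p)) :
    IsPotentiallyDiagonalizable 𝔅 (FramedRep.conj P ρ) ↔ IsPotentiallyDiagonalizable 𝔅 ρ := by
  have key : ∀ (K' : IntermediateField K (AlgebraicClosure K)) (g : GL (Fin n) (PadicAlgCl p)),
      FramedRep.conj g (FramedGaloisRep.restrictField K' (FramedRep.conj P ρ)) =
        FramedRep.conj (g * P) (ρ.restrictField K') := by
    intro K' g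
    exact ContinuousMonoidHom.ext fun σ => by simp [mul_assoc]
  constructor
  · rintro ⟨K', hK', g, h⟩
    exact ⟨K', hK', g * P, key K' g ▸ h⟩
  · rintro ⟨K', hK', g, h⟩
    refine ⟨K', hK', g * P⁻¹, ?_⟩
    rw [key, inv_mul_cancel_right]
    exact h

/-- A representation whose restriction to some `Γ_{K'}` is already diagonalizable (lattice `g = 1`) is
potentially diagonalizable. [cite: BarnetlambEtAl2014, §1.4] -/
theorem IsDiagonalizableOver.isPotentiallyDiagonalizable {𝔅 : CrystallineExtensionData.{u, w} p K}
    {K' : IntermediateField K (AlgebraicClosure K)} {hK' : FiniteDimensional K K'}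
    {ρ : FramedGaloisRep K (PadicAlgCl p) n}
    (h : IsDiagonalizableOver 𝔅 K' hK' (ρ.restrictField K')) :
    IsPotentiallyDiagonalizable 𝔅 ρ := by
  refine ⟨K', hK', 1, ?_⟩
  have : FramedRep.conj 1 (ρ.restrictField K') = ρ.restrictField K' :=
    ContinuousMonoidHom.ext fun σ => by simp
  rw [this]
  exact h

/-- Diagonalizable (over `K`, i.e. over `⊥`) implies potentially diagonalizable (`K' = K` in BLGGT's
definition). [cite: BarnetlambEtAl2014, §1.4] -/
theorem IsDiagonalizable.isPotentiallyDiagonalizable {𝔅 : CrystallineExtensionData.{u, w} p K}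
    {ρ : FramedGaloisRep K (PadicAlgCl p) n} (h : IsDiagonalizable 𝔅 ρ) :
    IsPotentiallyDiagonalizable 𝔅 ρ :=
  IsDiagonalizableOver.isPotentiallyDiagonalizable h

end Crystalline

/-! ### Trivial action is admissible for every period-ring datum -/

namespace PeriodRingData

section Trivial

-- Mathlib's own global value (see the implementation note in `PAdicHodgeProofs`): nested instance
-- problems on `𝔅.B ⊗[P] M`.
set_option maxSynthPendingDepth 3

open scoped TensorProduct

universe u' v₁ v' w₀ w'

variable {Γ : Type u'} [Group Γ] [TopologicalSpace Γ] {P : Type v₁} {E : Type v'} [Field P]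
  [TopologicalSpace P] [Field E] [Algebra P E]
  {M : Type w'} [AddCommGroup M] [Module P M] [TopologicalSpace M]
  (𝔅 : PeriodRingData.{u', v₁, v', w₀} Γ P E) (ρ : ContinuousRep Γ P M)

/-- **A representation with trivial `Γ`-action is `B`-admissible for every period-ring datum**:
`D_B(V) ⊇ 1 ⊗ V`, and the vectors `1 ⊗ b_i` (`b` a `P`-basis of `V`) form a `B`-basis of `B ⊗_P V`, hence are
`E`-linearly independent (`E ↪ B`), so `dim_E D_B(V) ≥ dim_P V`; equality by Fontaine's inequality
`finrank_D_le_holds`.  Ref: Fontaine, Astérisque 223 (1994), Exposé III §1.5 (the trivial representation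
`B^Γ = E` is `B`-admissible). [folklore] -/
theorem isAdmissible_of_forall_apply_eq [FiniteDimensional P M] (h : ∀ (σ : Γ) (v : M), ρ σ v = v) :
    𝔅.IsAdmissible ρ := by
  classical
  let b := Module.finBasis P M
  -- the vectors `1 ⊗ b i` are `Γ`-invariant
  have hmem : ∀ i, (1 : 𝔅.B) ⊗ₜ[P] b i ∈ 𝔅.D ρ := fun i =>
    (𝔅.mem_D_iff ρ _).2 fun σ => by rw [tensorRep_apply_tmul, smul_one, h]
  -- they form a `B`-basis of `B ⊗ M`, hence are `E`-linearly independent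
  have hliB : LinearIndependent 𝔅.B (fun i => (1 : 𝔅.B) ⊗ₜ[P] b i) := by
    convert (Algebra.TensorProduct.basis 𝔅.B b).linearIndependent using 1
    exact funext fun i => (Algebra.TensorProduct.basis_apply b i).symm
  have hinj : Function.Injective fun e : E => e • (1 : 𝔅.B) := by
    simpa only [← Algebra.algebraMap_eq_smul_one] using (algebraMap E 𝔅.B).injective
  have hliE : LinearIndependent E (fun i => (1 : 𝔅.B) ⊗ₜ[P] b i) := hliB.restrict_scalars hinj
  have hliD : LinearIndependent E (fun i => (⟨(1 : 𝔅.B) ⊗ₜ[P] b i, hmem i⟩ : 𝔅.D ρ)) :=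
    LinearIndependent.of_comp (𝔅.D ρ).subtype hliE
  -- `D` has rank `≤ dim_P M` (Fontaine's inequality), hence is finite-dimensional
  have hle : Module.finrank E (𝔅.D ρ) ≤ Module.finrank P M := 𝔅.finrank_D_le_holds ρ
  have hrank : Module.rank E (𝔅.D ρ) ≤ Module.finrank P M := by
    refine rank_le fun s hs => ?_
    have h1 : LinearIndependent E (fun i : s => ((i : 𝔅.D ρ) : 𝔅.B ⊗[P] M)) :=
      hs.map' (𝔅.D ρ).subtype (Submodule.ker_subtype _)
    have h2 : LinearIndependent 𝔅.B (fun i : s => ((i : 𝔅.D ρ) : 𝔅.B ⊗[P] M)) :=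
      𝔅.linearIndependent_of_mem_D ρ (fun i => (i : 𝔅.D ρ).2) h1
    have h3 := h2.fintype_card_le_finrank
    rw [Fintype.card_coe] at h3
    exact h3.trans_eq Module.finrank_baseChange
  haveI : Module.Finite E (𝔅.D ρ) :=
    Module.rank_lt_aleph0_iff.mp (hrank.trans_lt Cardinal.natCast_lt_aleph0)
  refine le_antisymm hle ?_
  have h4 := hliD.fintype_card_le_finrank
  rwa [Fintype.card_fin] at h4

end Trivial

end PeriodRingData

/-! ### The trivial family over `ℤ_p` and non-vacuity -/

section TrivialFamily

variable {p : ℕ} [Fact p.Prime]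

/-- The isomorphism `𝒪_⊥ → ℤ_p` for the bottom field `⊥ = ℚ_p ⊆ ℚ̄_p` (through `IntermediateField.botEquiv`;
the norm of `ℚ̄_p` extends that of `ℚ_p`, `PadicAlgCl.norm_extends`). [folklore] -/
def padicCoeffRingBotToPadicInt :
    padicCoeffRing (⊥ : IntermediateField ℚ_[p] (PadicAlgCl p)) →+* ℤ_[p] :=
  ((IntermediateField.botEquiv ℚ_[p] (PadicAlgCl p)).toAlgHom.toRingHom.comp
    (padicCoeffRing _).subtype).codRestrict (PadicInt.subring p) fun x => by
      have hx := (mem_padicCoeffRing_iff _ _).1 x.2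
      rw [← (IntermediateField.botEquiv ℚ_[p] (PadicAlgCl p)).symm_apply_apply
        (x : (⊥ : IntermediateField ℚ_[p] (PadicAlgCl p))), IntermediateField.botEquiv_symm,
        IntermediateField.coe_algebraMap_apply] at hx
      rw [PadicInt.mem_subring_iff, ← PadicAlgCl.norm_extends]
      exact hx

/-- The isomorphism `ℤ_p → 𝒪_⊥` for the bottom field `⊥ = ℚ_p ⊆ ℚ̄_p`. [folklore] -/
def padicIntToPadicCoeffRingBot :
    ℤ_[p] →+* padicCoeffRing (⊥ : IntermediateField ℚ_[p] (PadicAlgCl p)) :=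
  ((algebraMap ℚ_[p] (⊥ : IntermediateField ℚ_[p] (PadicAlgCl p))).comp
    (PadicInt.Coe.ringHom (p := p))).codRestrict (padicCoeffRing _) fun x => by
      rw [mem_padicCoeffRing_iff, RingHom.comp_apply, IntermediateField.coe_algebraMap_apply]
      change ‖((x : ℚ_[p]) : PadicAlgCl p)‖ ≤ 1
      rw [PadicAlgCl.norm_extends]
      exact x.2

/-- `ℤ_p → 𝒪_⊥ → ℤ_p` is the identity. [folklore] -/
@[simp] lemma padicCoeffRingBotToPadicInt_padicIntTo (x : ℤ_[p]) :
    padicCoeffRingBotToPadicInt (padicIntToPadicCoeffRingBot x) = x := by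
  apply Subtype.ext
  change IntermediateField.botEquiv ℚ_[p] (PadicAlgCl p)
    (algebraMap ℚ_[p] (⊥ : IntermediateField ℚ_[p] (PadicAlgCl p)) (x : ℚ_[p])) = x
  exact IntermediateField.botEquiv_def (x : ℚ_[p])

/-- `𝒪_⊥ → ℤ_p → 𝒪_⊥` is the identity. [folklore] -/
@[simp] lemma padicIntTo_padicCoeffRingBotToPadicInt
    (x : padicCoeffRing (⊥ : IntermediateField ℚ_[p] (PadicAlgCl p))) :
    padicIntToPadicCoeffRingBot (padicCoeffRingBotToPadicInt x) = x := by
  apply Subtype.ext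
  change algebraMap ℚ_[p] (⊥ : IntermediateField ℚ_[p] (PadicAlgCl p))
    (IntermediateField.botEquiv ℚ_[p] (PadicAlgCl p) x) = x
  rw [← IntermediateField.botEquiv_symm, AlgEquiv.symm_apply_apply]

universe u'
variable (p)

/-- The **trivial connecting family**: `E = ℚ_p` (`= ⊥`), `A = ℤ_p` (a complete discrete valuation ring
with residue field `𝔽_p`), the trivial representation `rep = 1`, both endpoints the identity.  Its
specialisations are all trivial (`trivial_specialize`). [folklore] -/
def ConnectingFamily.trivial (Γ : Type u') [Group Γ] [TopologicalSpace Γ] (n : ℕ) :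
    ConnectingFamily p Γ n where
  E := ⊥
  finiteDimensional := inferInstance
  A := ℤ_[p]
  structureMap := padicCoeffRingBotToPadicInt
  residue_comp_surjective := by
    rw [RingHom.coe_comp]
    refine IsLocalRing.residue_surjective.comp fun x => ⟨padicIntToPadicCoeffRingBot x, ?_⟩
    exact padicCoeffRingBotToPadicInt_padicIntTo x
  rep := 1
  isOpen_setOf_congr k := by
    convert isOpen_univ
    refine Set.eq_univ_of_forall fun σ i j => ?_
    simp
  left := padicIntToPadicCoeffRingBot
  right := padicIntToPadicCoeffRingBot
  left_comp := RingHom.ext padicIntTo_padicCoeffRingBotToPadicInt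
  right_comp := RingHom.ext padicIntTo_padicCoeffRingBotToPadicInt

variable {p}
variable {Γ : Type u'} [Group Γ] [TopologicalSpace Γ] {n : ℕ}

/-- Every specialisation of the trivial family is the trivial representation. [folklore] -/
@[simp] lemma ConnectingFamily.trivial_specialize (y : ℤ_[p] →+* PadicAlgCl p) :
    (ConnectingFamily.trivial p Γ n).specialize y = fun _ => 1 := by
  funext σ
  change ((1 : GL (Fin n) ℤ_[p]) : Matrix (Fin n) (Fin n) ℤ_[p]).map y = 1
  rw [Units.val_one, Matrix.map_one _ (map_zero y) (map_one y)]

/-- The first endpoint of the trivial family is trivial. [folklore] -/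
@[simp] lemma ConnectingFamily.trivial_leftFn :
    (ConnectingFamily.trivial p Γ n).leftFn = fun _ => 1 :=
  ConnectingFamily.trivial_specialize _

/-- The second endpoint of the trivial family is trivial. [folklore] -/
@[simp] lemma ConnectingFamily.trivial_rightFn :
    (ConnectingFamily.trivial p Γ n).rightFn = fun _ => 1 :=
  ConnectingFamily.trivial_specialize _

end TrivialFamily

section NonVacuity

variable {p : ℕ} [Fact p.Prime]

/-- **The trivial representation is crystalline for every datum**: a model of the constant function `1`
is the trivial representation (the map `M_n(E') → M_n(ℚ̄_p)` is injective), whose `ℚ_p`-restriction has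
trivial action, hence is admissible (`PeriodRingData.isAdmissible_of_forall_apply_eq`).
Ref: Fontaine, Astérisque 223 (1994), Exposé III §1.5. [folklore] -/
theorem isCrystallineFn_one {L : Type u} [Field L] [Algebra ℚ_[p] L]
    (𝔅 : CrystallinePeriodRingData.{0, u, w} ℚ_[p] L) (n : ℕ) :
    IsCrystallineFn 𝔅 (fun _ : absoluteGaloisGroup L => (1 : Matrix (Fin n) (Fin n) (PadicAlgCl p))) := by
  intro E' hE' r hr
  haveI := hE'
  refine PeriodRingData.isAdmissible_of_forall_apply_eq _ _ fun σ v => ?_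
  have h1 : r.matrixFn σ = 1 := by
    apply Matrix.map_injective (algebraMap E' (PadicAlgCl p)).injective
    change (r.matrixFn σ).map _ = (1 : Matrix (Fin n) (Fin n) E').map _
    rw [hr σ, Matrix.map_one _ (map_zero _) (map_one _)]
  change ((r σ : GL (Fin n) E') : Matrix (Fin n) (Fin n) E') *ᵥ v = v
  rw [show ((r σ : GL (Fin n) E') : Matrix (Fin n) (Fin n) E') = 1 from h1, Matrix.one_mulVec]

variable {K : Type u} [Field K] [Algebra ℚ_[p] K] {n : ℕ}

/-- **Non-vacuity: the trivial representation is potentially diagonalizable, for every datum** (indeed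
diagonalizable over `K`, via the trivial family over `ℤ_p` connecting `1` to the diagonal representation
`1 = 1 ⊕ ⋯ ⊕ 1`; BLGGT §1.4: unramified representations, in particular sums of unramified characters, are
crystalline, and `ρ ~ ρ`). [cite: BarnetlambEtAl2014, §1.4] -/
theorem isPotentiallyDiagonalizable_one (𝔅 : CrystallineExtensionData.{u, w} p K) :
    IsPotentiallyDiagonalizable 𝔅 (1 : FramedGaloisRep K (PadicAlgCl p) n) := by
  refine ⟨⊥, inferInstance, 1, ?_⟩
  have hconj : (FramedRep.conj 1 ((1 : FramedGaloisRep K (PadicAlgCl p) n).restrictField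
      (⊥ : IntermediateField K (AlgebraicClosure K)))).matrixFn = fun _ => 1 := by
    funext σ; simp [FramedRep.matrixFn]
  have hone : (1 : FramedGaloisRep (⊥ : IntermediateField K (AlgebraicClosure K)) (PadicAlgCl p) n).matrixFn
      = fun _ => 1 := by
    funext σ; simp [FramedRep.matrixFn]
  refine ⟨?_, 1, ?_, ?_, ?_⟩
  · rw [hconj]; exact isCrystallineFn_one _ _
  · intro σ i j hij; simp [FramedRep.matrixFn, Matrix.one_apply_ne hij]
  · rw [hone]; exact isCrystallineFn_one _ _
  · refine ⟨⊥, le_rfl, inferInstance, ConnectingFamily.trivial p _ n, 1, ?_, ?_, ?_, ?_⟩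
    · intro i j
      simp only [inv_one, Units.val_one]
      by_cases hij : i = j
      · subst hij; simp
      · simp [Matrix.one_apply_ne hij]
    · rw [ConnectingFamily.trivial_leftFn, hconj]
    · rw [ConnectingFamily.trivial_rightFn]; funext σ; simp [FramedRep.matrixFn]
    · intro y _
      rw [ConnectingFamily.trivial_specialize]
      exact isCrystallineFn_one _ _

end NonVacuity

end Literature.NumberTheory.GaloisRepresentations
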